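import Summits.AnomalousDissipation.AnomalousDissipation.Theses.MomentParity
import Summits.AnomalousDissipation.AnomalousDissipation.Theorems.QuarticGate.Negative.EnergyRow
import Literature.Analysis.FluidPDE.StatisticalSolutionEnergyEq
import Literature.Analysis.FluidPDE.StatisticalSolutionProofs
import Literature.Analysis.FluidPDE.SteadyNavierStokesEnergy
import Literature.Analysis.FluidPDE.SteadyNavierStokesProofs
import Literature.Analysis.FluidPDE.CylindricalGenerator

/-!
# Stub P1 `stub_energyEq_of_stressMoment` for line `lions-l4-domination` of crux
# `MomentParity.ResolvedDissipation` (stmt-AnomalousDissipation-14284)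

**The conditional mean energy EQUALITY of stationary statistical solutions, `2 ≤ d ≤ 4` (in
particular on `T³`).** A stationary statistical solution `μ` of the space-periodic Navier–Stokes
equations at `(ν, f)`, `f ∈ L²` (`Torus.IsStationaryStatisticalSolution`, FMRT 2001, Ch. IV
Def. 1.3), whose inertial force `B(u,u) = P_σ ∇·(u ⊗ u)` has a finite second `V′`-moment
`∫ ‖B(u,u)‖²_{V′} dμ < ∞`, `‖B(u,u)‖_{V′} = sup {|∫ (u ⊗ u) : ∇w| : w ∈ 𝒱, ‖∇w‖₂² ≤ 1}` (written
with the tree's `Torus.inertialPairing`), satisfies `ν ∫ ‖∇u‖² dμ = ∫ (f, u) dμ`, for every real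
`ν`. In `d = 3` only the inequality is known unconditionally (FMRT 2001, Ch. IV (1.31)); the
finite stress moment is the ensemble form of the Lions–Shinbrot `L⁴L⁴` class
(`‖B(u,u)‖_{V′} ≤ ‖u‖²_{L⁴}`).

The proof is the tree's Galerkin proof of the two-dimensional energy equation
(`Torus.IsStationaryStatisticalSolution.energy_eq_holds`): the Liouville equation tested on
`galerkinTest m ha` makes the weighted Galerkin balances vanish in the mean
(`integral_galerkinBalance_eq_zero`), and one lets `m → ∞`, then `a → ∞`, by dominated
convergence, with the two two-dimensional ingredients replaced by
* *domination*: `P_m u ∈ 𝒱`, so by scaling inside the supremum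
  `|∫ (u ⊗ u) : ∇P_m u| ≤ ‖B(u,u)‖_{V′} (‖∇P_m u‖₂² + 1)^{1/2} ≤ ½ (‖B(u,u)‖²_{V′} + ‖∇u‖₂² + 1)`,
  `μ`-integrable (`abs_inertialPairing_fourierTruncate_le_stress`);
* *pointwise limit*: `∫ (u ⊗ u) : ∇P_m u → 0` for `u ∈ V`, `2 ≤ d ≤ 4`, by `H¹ ⊂ L⁴`
  (`Torus.tendsto_inertialPairing_fourierTruncate_of_card_le_four`), `μ`-a.e. `u ∈ V` by (1.29).

## References

* C. Foias, O. Manley, R. Rosa, R. Temam, *Navier–Stokes Equations and Turbulence*, Cambridge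
  Univ. Press (2001), Ch. IV §1.2 Def. 1.3, (1.29)–(1.31); §2 Thm. 2.2; App. B.1. [FMRTTurbulence2001]
* J.-L. Lions, Rend. Sem. Mat. Univ. Padova 30 (1960) 16–23; M. Shinbrot, *The energy equation
  for the Navier–Stokes system*, SIAM J. Math. Anal. 5 (1974) 948–954.
-/

noncomputable section

set_option linter.dupNamespace false

namespace Summit.AnomalousDissipation.AnomalousDissipation.Theorems.MomentParityResolvedDissipation.StressEnergyEq

open MeasureTheory Filter Topology
open scoped ENNReal NNReal InnerProductSpace RealInnerProductSpace
open Literature.Analysis.FunctionSpaces Literature.Analysis.FluidPDE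
open Summit.AnomalousDissipation.AnomalousDissipation.Theses.MomentParity
open Summit.AnomalousDissipation.AnomalousDissipation.Theorems.QuarticGate.Negative

variable {d : Type*} [Fintype d] [DecidableEq d]

/-! ### Scalings of admissible test fields -/

omit [DecidableEq d] in
/-- **Scaling of the spectral enstrophy**: `‖∇(c • w)‖₂² = c² ‖∇w‖₂²` (the Fourier coefficients
of `complexify ∘ (c • w) = (c : ℂ) • (complexify ∘ w)` scale by `c`). [folklore] -/
theorem eGradNormSq_const_smul (c : ℝ) (w : UnitAddTorus d → EuclideanSpace ℝ d) :
    Torus.eGradNormSq (c • w) = ENNReal.ofReal (c ^ 2) * Torus.eGradNormSq w := by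
  have complexify_comp_const_smul :
      EuclideanSpace.complexify ∘ (c • w) = (c : ℂ) • (EuclideanSpace.complexify ∘ w) := by
    funext x
    ext i
    simp [EuclideanSpace.complexify_apply]
  rw [Torus.eGradNormSq_eq_tsum, Torus.eGradNormSq_eq_tsum]
  have hterm : ∀ k : d → ℤ, ENNReal.ofReal (Torus.freqNormSq k) *
      ‖UnitAddTorus.mFourierCoeff (EuclideanSpace.complexify ∘ (c • w)) k‖ₑ ^ 2 =
        ENNReal.ofReal (c ^ 2) * (ENNReal.ofReal (Torus.freqNormSq k) *
          ‖UnitAddTorus.mFourierCoeff (EuclideanSpace.complexify ∘ w) k‖ₑ ^ 2) := by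
    intro k
    rw [complexify_comp_const_smul, Torus.mFourierCoeff_const_smul, enorm_smul, mul_pow]
    have h2 : ‖(c : ℂ)‖ₑ ^ 2 = ENNReal.ofReal (c ^ 2) := by
      rw [← ofReal_norm, Complex.norm_real, Real.norm_eq_abs, ← ENNReal.ofReal_pow (abs_nonneg c),
        sq_abs]
    rw [h2]
    ring
  simp_rw [hterm]
  rw [ENNReal.tsum_mul_left]
  ring

/-- Scalings of smooth divergence-free fields are divergence free. [folklore] -/
theorem isDivFree_const_smul {w : UnitAddTorus d → EuclideanSpace ℝ d} (hw : Torus.IsSmooth w)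
    (hdiv : Torus.IsDivFree w) (c : ℝ) : Torus.IsDivFree (c • w) := by
  intro x
  have hwi : ∀ i, Torus.IsContDiff 1 (fun y => w y i) := fun i =>
    (EuclideanSpace.proj i : EuclideanSpace ℝ d →L[ℝ] ℝ).contDiff.comp (hw.isContDiff (by simp))
  have hci : ∀ i, (fun y => (c • w) y i) = c • fun y => w y i := fun i => by
    funext y
    simp
  have h : Torus.divergence (c • w) x = c * Torus.divergence w x := by
    unfold Torus.divergence
    rw [Finset.mul_sum]
    refine Finset.sum_congr rfl fun i _ => ?_
    rw [hci i, Torus.partialDeriv_const_smul (hwi i)]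
    rfl
  rw [h, hdiv x, mul_zero]

omit [DecidableEq d] in
/-- Scalings of mean-zero fields have zero mean. [folklore] -/
theorem hasZeroMean_const_smul {w : UnitAddTorus d → EuclideanSpace ℝ d} (h0 : Torus.HasZeroMean w)
    (c : ℝ) : Torus.HasZeroMean (c • w) := by
  change ∫ x, c • w x = 0
  rw [integral_smul, show ∫ x, w x = 0 from h0, smul_zero]

omit [DecidableEq d] in
/-- Homogeneity of the inertial pairing `∫ (u ⊗ u) : ∇w` in the smooth test field `w`. [folklore] -/
theorem inertialPairing_const_smul (u : Lp (EuclideanSpace ℝ d) 2 (volume : Measure (UnitAddTorus d)))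
    {w : UnitAddTorus d → EuclideanSpace ℝ d} (hw : Torus.IsSmooth w) (c : ℝ) :
    Torus.inertialPairing u (c • w) = c * Torus.inertialPairing u w := by
  unfold Torus.inertialPairing
  rw [← integral_const_mul]
  refine integral_congr_ae (ae_of_all _ fun x => ?_)
  dsimp only
  rw [Torus.fderiv_const_smul (hw.isContDiff (by simp)) c x, FunLike.coe_smul, Pi.smul_apply,
    real_inner_smul_left]

/-! ### Domination of the Galerkin inertial term by the Reynolds-stress dual norm -/

/-- **Domination of the Galerkin inertial term by the stress functional.** For `u ∈ H` with
finite Reynolds-stress dual norm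
`D(u) = sup {|∫ (u ⊗ u) : ∇w| : w smooth, div-free, mean-zero, ‖∇w‖₂² ≤ 1}`, every Galerkin
truncation satisfies `|∫ (u ⊗ u) : ∇P_m u| ≤ D(u) (‖∇P_m u‖₂² + 1)^{1/2}`: the field
`(‖∇P_m u‖₂² + 1)^{-1/2} P_m u` is admissible in the supremum (`P_m u ∈ 𝒱`:
`isSmooth_fourierTruncate`, `isDivFree_fourierTruncate`, `hasZeroMean_fourierTruncate_of_mem`).
[folklore] -/
theorem abs_inertialPairing_fourierTruncate_le_stress (u : Torus.energySpace d) (m : ℕ)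
    (hD : (⨆ (w : UnitAddTorus d → EuclideanSpace ℝ d)
          (_ : Torus.IsSmooth w ∧ Torus.IsDivFree w ∧ Torus.HasZeroMean w ∧ Torus.eGradNormSq w ≤ 1),
          ‖Torus.inertialPairing u.1 w‖ₑ) ≠ ⊤) :
    |Torus.inertialPairing u.1
        (Torus.fourierTruncate m (u.1 : UnitAddTorus d → EuclideanSpace ℝ d))| ≤
      (⨆ (w : UnitAddTorus d → EuclideanSpace ℝ d)
          (_ : Torus.IsSmooth w ∧ Torus.IsDivFree w ∧ Torus.HasZeroMean w ∧ Torus.eGradNormSq w ≤ 1),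
          ‖Torus.inertialPairing u.1 w‖ₑ).toReal *
        Real.sqrt ((Torus.eGradNormSq
          (Torus.fourierTruncate m (u.1 : UnitAddTorus d → EuclideanSpace ℝ d))).toReal + 1) := by
  set D : ℝ≥0∞ := ⨆ (w : UnitAddTorus d → EuclideanSpace ℝ d)
      (_ : Torus.IsSmooth w ∧ Torus.IsDivFree w ∧ Torus.HasZeroMean w ∧ Torus.eGradNormSq w ≤ 1),
      ‖Torus.inertialPairing u.1 w‖ₑ with hD_def
  set w₀ : UnitAddTorus d → EuclideanSpace ℝ d :=
    Torus.fourierTruncate m (u.1 : UnitAddTorus d → EuclideanSpace ℝ d) with hw₀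
  have hsm : Torus.IsSmooth w₀ := Torus.isSmooth_fourierTruncate m _
  have hdf : Torus.IsDivFree w₀ :=
    Torus.isDivFree_fourierTruncate (Lp.memLp _) (Torus.isWeaklyDivFree_of_mem_energySpace u.2) m
  have hzm : Torus.HasZeroMean w₀ := Torus.hasZeroMean_fourierTruncate_of_mem u.2 m
  have hfin : Torus.eGradNormSq w₀ ≠ ⊤ := (Torus.eGradNormSq_lt_top hsm).ne
  have hT0 : 0 ≤ (Torus.eGradNormSq w₀).toReal := ENNReal.toReal_nonneg
  have hs : 0 < Real.sqrt ((Torus.eGradNormSq w₀).toReal + 1) := Real.sqrt_pos.2 (by linarith)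
  set c : ℝ := (Real.sqrt ((Torus.eGradNormSq w₀).toReal + 1))⁻¹ with hc_def
  have hc : 0 < c := inv_pos.2 hs
  -- the rescaled truncation is admissible in the supremum
  have hadm : Torus.IsSmooth (c • w₀) ∧ Torus.IsDivFree (c • w₀) ∧ Torus.HasZeroMean (c • w₀) ∧
      Torus.eGradNormSq (c • w₀) ≤ 1 := by
    refine ⟨hsm.smul c, isDivFree_const_smul hsm hdf c, hasZeroMean_const_smul hzm c, ?_⟩
    rw [eGradNormSq_const_smul, ← ENNReal.ofReal_toReal hfin, ← ENNReal.ofReal_mul (sq_nonneg _),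
      ← ENNReal.ofReal_one]
    refine ENNReal.ofReal_le_ofReal ?_
    rw [hc_def, inv_pow, Real.sq_sqrt (by linarith), inv_mul_le_iff₀ (by linarith)]
    linarith
  have hle : ‖Torus.inertialPairing u.1 (c • w₀)‖ₑ ≤ D :=
    le_iSup₂ (f := fun (w : UnitAddTorus d → EuclideanSpace ℝ d)
      (_ : Torus.IsSmooth w ∧ Torus.IsDivFree w ∧ Torus.HasZeroMean w ∧ Torus.eGradNormSq w ≤ 1) =>
        ‖Torus.inertialPairing u.1 w‖ₑ) (c • w₀) hadm
  rw [inertialPairing_const_smul _ hsm, Real.enorm_eq_ofReal_abs, ENNReal.ofReal_le_iff_le_toReal hD,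
    abs_mul, abs_of_pos hc] at hle
  have hcs : c * Real.sqrt ((Torus.eGradNormSq w₀).toReal + 1) = 1 := inv_mul_cancel₀ hs.ne'
  calc |Torus.inertialPairing u.1 w₀|
      = c * |Torus.inertialPairing u.1 w₀| * Real.sqrt ((Torus.eGradNormSq w₀).toReal + 1) := by
        rw [mul_right_comm, hcs, one_mul]
    _ ≤ D.toReal * Real.sqrt ((Torus.eGradNormSq w₀).toReal + 1) := by gcongr

/-! ### The conditional mean energy equality -/

/-- **The mean energy EQUALITY of a stationary statistical solution with finite Reynolds-stress
second moment, `2 ≤ d ≤ 4`, every real `ν`.** If `μ` is a stationary statistical solution of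
the space-periodic Navier–Stokes equations at `(ν, f)` (FMRT 2001, Ch. IV Def. 1.3), `f ∈ L²`,
and `∫ D(u)² dμ(u) < ∞` for the Reynolds-stress dual norm
`D(u) = sup {|∫ (u ⊗ u) : ∇w| : w ∈ 𝒱, ‖∇w‖₂² ≤ 1}`, then `ν ∫ ‖∇u‖² dμ = ∫ (u, f) dμ`.
Proof: the Galerkin argument of `IsStationaryStatisticalSolution.energy_eq_holds`
(`integral_galerkinBalance_eq_zero`, `m → ∞` then `a → ∞` by dominated convergence), with the
inertial term dominated by `½ (D(u)² + ‖∇u‖² + 1)` (`abs_inertialPairing_fourierTruncate_le_stress`,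
`eGradNormSq_fourierTruncate_le`) and tending to `0` for `μ`-a.e. `u`
(`tendsto_inertialPairing_fourierTruncate_of_card_le_four`, finite mean enstrophy). In `d = 2`
the hypothesis is automatic on finite-enstrophy fields (Ladyzhenskaya); in `d = 3` it is the
ensemble form of the Lions–Shinbrot `L⁴L⁴` condition for the energy equality.
[cite: FMRTTurbulence2001, Ch. IV §2 Thm. 2.2 with App. B.1 (d = 2 energy equation); Def. 1.3 (1.29)–(1.31)] -/
theorem energy_eq_of_stressMoment (hd2 : 2 ≤ Fintype.card d) (hd4 : Fintype.card d ≤ 4)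
    {ν : ℝ} {f : UnitAddTorus d → EuclideanSpace ℝ d} {μ : Measure (Torus.energySpace d)}
    (hμ : Torus.IsStationaryStatisticalSolution ν f μ) (hf : MemLp f 2 volume)
    (hS : ∫⁻ u, (⨆ (w : UnitAddTorus d → EuclideanSpace ℝ d)
          (_ : Torus.IsSmooth w ∧ Torus.IsDivFree w ∧ Torus.HasZeroMean w ∧ Torus.eGradNormSq w ≤ 1),
          ‖Torus.inertialPairing u.1 w‖ₑ) ^ 2 ∂μ ≠ ⊤) :
    ν * (Torus.ensembleEnstrophy μ).toReal = ∫ u, Torus.pairing u.1 f ∂μ := by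
  haveI := hμ.prob
  obtain ⟨Cw, hCw1, hCw⟩ := Torus.exists_abs_galerkinWeight_le
  have hCw0 : 0 ≤ Cw := zero_le_one.trans hCw1
  -- the stress functional: lower semicontinuous, hence measurable; a.e. finite; square integrable
  set D : Torus.energySpace d → ℝ≥0∞ := fun u => ⨆ (w : UnitAddTorus d → EuclideanSpace ℝ d)
      (_ : Torus.IsSmooth w ∧ Torus.IsDivFree w ∧ Torus.HasZeroMean w ∧ Torus.eGradNormSq w ≤ 1),
      ‖Torus.inertialPairing u.1 w‖ₑ with hD
  have hDlsc : LowerSemicontinuous D :=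
    lowerSemicontinuous_biSup fun w hw =>
      ((Torus.continuous_inertialPairing_coe hw.1).enorm).lowerSemicontinuous
  have hD2meas : Measurable fun u => D u ^ 2 := hDlsc.measurable.pow_const 2
  have hS' : ∫⁻ u, D u ^ 2 ∂μ ≠ ⊤ := hS
  have hDae : ∀ᵐ u ∂μ, D u < ⊤ := by
    filter_upwards [ae_lt_top hD2meas hS'] with u hu
    exact (ENNReal.pow_lt_top_iff.1 hu).resolve_right two_ne_zero
  have hI3 : Integrable (fun u => (D u ^ 2).toReal) μ :=
    integrable_toReal_of_lintegral_ne_top hD2meas.aemeasurable hS'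
  -- abbreviations and integrability
  set G : Torus.energySpace d → ℝ := fun u =>
    (Torus.eGradNormSq (u.1 : UnitAddTorus d → EuclideanSpace ℝ d)).toReal with hG
  set Flim : Torus.energySpace d → ℝ := fun u =>
    (∫ x, ⟪f x, (u.1 : UnitAddTorus d → EuclideanSpace ℝ d) x⟫_ℝ) - ν * G u with hFlim
  have hpair : ∀ u : Torus.energySpace d,
      ∫ x, ⟪f x, (u.1 : UnitAddTorus d → EuclideanSpace ℝ d) x⟫_ℝ = Torus.pairing u.1 f := by
    intro u
    rw [Torus.pairing]
    exact integral_congr_ae (ae_of_all _ fun x => real_inner_comm _ _)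
  have hI1 : Integrable (fun u : Torus.energySpace d => Torus.pairing u.1 f) μ :=
    hμ.integrable_pairing hf
  have hI2 : Integrable G μ := hμ.integrable_toReal_eGradNormSq
  have hFlim_int : Integrable Flim μ := by
    have h : Flim = fun u : Torus.energySpace d => Torus.pairing u.1 f - ν * G u := by
      funext u
      rw [hFlim]
      dsimp only
      rw [hpair]
    rw [h]
    exact hI1.sub (hI2.const_mul ν)
  -- Step 1: for every level `a = n + 1`, `∫ w(|u|²/a) Flim dμ = 0` (limit `m → ∞`)
  have hlevel : ∀ n : ℕ, ∫ u, Torus.galerkinWeight (‖u‖ ^ 2 / ((n : ℝ) + 1)) * Flim u ∂μ = 0 := by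
    intro n
    have ha : (0 : ℝ) < (n : ℝ) + 1 := by positivity
    set a : ℝ := (n : ℝ) + 1 with ha_def
    set F : ℕ → Torus.energySpace d → ℝ := fun m u =>
      Torus.galerkinWeight (Torus.truncNormSq m u / a) * Torus.galerkinBalance ν f m u with hF
    have hFint : ∀ m, Integrable (F m) μ := fun m => (hμ.integral_galerkinBalance_eq_zero m ha).1
    have hFzero : ∀ m, ∫ u, F m u ∂μ = 0 := fun m => (hμ.integral_galerkinBalance_eq_zero m ha).2
    set bound : Torus.energySpace d → ℝ := fun u =>
      Cw * (2⁻¹ * ((∫ x, ‖f x‖ ^ 2) + ‖u‖ ^ 2) + |ν| * G u +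
        2⁻¹ * ((D u ^ 2).toReal + (G u + 1))) with hbound
    have hbound_int : Integrable bound μ :=
      (((((integrable_const _).add hμ.integrable_norm_sq).const_mul _).add (hI2.const_mul _)).add
        ((hI3.add (hI2.add (integrable_const _))).const_mul _)).const_mul _
    -- domination
    have hdom : ∀ m, ∀ᵐ u ∂μ, ‖F m u‖ ≤ bound u := by
      intro m
      filter_upwards [hμ.ae_eGradNormSq_lt_top, hDae] with u hufin hDu
      have hmem : MemLp (u.1 : UnitAddTorus d → EuclideanSpace ℝ d) 2 volume := Lp.memLp _
      have hint : Integrable (u.1 : UnitAddTorus d → EuclideanSpace ℝ d) volume :=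
        hmem.integrable one_le_two
      have hG0 : 0 ≤ G u := ENNReal.toReal_nonneg
      have hD0 : 0 ≤ (D u ^ 2).toReal := ENNReal.toReal_nonneg
      have hbound0 : 0 ≤ bound u := by rw [hbound]; positivity
      by_cases ht : Torus.truncNormSq m u / a ≤ 2
      · -- on the support of the weight
        have h1 := Torus.abs_integral_inner_le hf (Torus.memLp_fourierTruncate m
          (u.1 : UnitAddTorus d → EuclideanSpace ℝ d) 2)
        have h1' := Torus.truncNormSq_le m u
        have h2 : (Torus.eGradNormSq (Torus.fourierTruncate m
            (u.1 : UnitAddTorus d → EuclideanSpace ℝ d))).toReal ≤ G u :=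
          ENNReal.toReal_mono hufin.ne (Torus.eGradNormSq_fourierTruncate_le hint m)
        have hGm0 : 0 ≤ (Torus.eGradNormSq (Torus.fourierTruncate m
            (u.1 : UnitAddTorus d → EuclideanSpace ℝ d))).toReal := ENNReal.toReal_nonneg
        have h3 : |Torus.inertialPairing u.1
            (Torus.fourierTruncate m (u.1 : UnitAddTorus d → EuclideanSpace ℝ d))| ≤
            (D u).toReal * Real.sqrt ((Torus.eGradNormSq (Torus.fourierTruncate m
              (u.1 : UnitAddTorus d → EuclideanSpace ℝ d))).toReal + 1) :=
          abs_inertialPairing_fourierTruncate_le_stress u m hDu.ne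
        have hsq : Real.sqrt ((Torus.eGradNormSq (Torus.fourierTruncate m
            (u.1 : UnitAddTorus d → EuclideanSpace ℝ d))).toReal + 1) ^ 2 ≤ G u + 1 := by
          rw [Real.sq_sqrt (by linarith)]
          linarith
        have h3' : |Torus.inertialPairing u.1
            (Torus.fourierTruncate m (u.1 : UnitAddTorus d → EuclideanSpace ℝ d))| ≤
            2⁻¹ * ((D u ^ 2).toReal + (G u + 1)) := by
          refine h3.trans ?_
          rw [ENNReal.toReal_pow]
          nlinarith [two_mul_le_add_sq (D u).toReal (Real.sqrt ((Torus.eGradNormSq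
            (Torus.fourierTruncate m (u.1 : UnitAddTorus d → EuclideanSpace ℝ d))).toReal + 1)), hsq]
        have hbal : |Torus.galerkinBalance ν f m u| ≤
            2⁻¹ * ((∫ x, ‖f x‖ ^ 2) + ‖u‖ ^ 2) + |ν| * G u +
              2⁻¹ * ((D u ^ 2).toReal + (G u + 1)) := by
          rw [Torus.galerkinBalance]
          refine (abs_add_le _ _).trans ((add_le_add (abs_sub _ _) le_rfl).trans ?_)
          rw [abs_mul]
          rw [Torus.truncNormSq] at h1'
          nlinarith [abs_nonneg ν, mul_le_mul_of_nonneg_left h2 (abs_nonneg ν),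
            abs_of_nonneg hGm0]
        rw [Real.norm_eq_abs, hF]
        dsimp only
        rw [abs_mul, hbound]
        exact mul_le_mul (hCw _) hbal (abs_nonneg _) hCw0
      · -- off the support the integrand vanishes
        have hw : Torus.galerkinWeight (Torus.truncNormSq m u / a) = 0 :=
          Torus.galerkinWeight_eq_zero ((not_le.1 ht).le.trans (le_abs_self _))
        rw [hF]
        dsimp only
        rw [hw, zero_mul, norm_zero]
        exact hbound0
    -- pointwise limit
    have hlim : ∀ᵐ u ∂μ, Tendsto (fun m => F m u) atTop
        (𝓝 (Torus.galerkinWeight (‖u‖ ^ 2 / a) * Flim u)) := by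
      filter_upwards [hμ.ae_eGradNormSq_lt_top] with u hufin
      have hmem : MemLp (u.1 : UnitAddTorus d → EuclideanSpace ℝ d) 2 volume := Lp.memLp _
      have hint : Integrable (u.1 : UnitAddTorus d → EuclideanSpace ℝ d) volume :=
        hmem.integrable one_le_two
      have tw : Tendsto (fun m => Torus.galerkinWeight (Torus.truncNormSq m u / a)) atTop
          (𝓝 (Torus.galerkinWeight (‖u‖ ^ 2 / a))) :=
        (Torus.continuous_galerkinWeight.tendsto _).comp ((Torus.tendsto_truncNormSq u).div_const a)
      have t1 := Torus.tendsto_integral_inner_fourierTruncate hf hmem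
      have t2 := (Torus.tendsto_toReal_eGradNormSq_fourierTruncate hint hufin.ne).const_mul ν
      have t3 := Torus.tendsto_inertialPairing_fourierTruncate_of_card_le_four hd2 hd4 u.2
        (Torus.memSobolev_one_complexify_of_eGradNormSq_ne_top hmem hufin.ne)
      have tb := (t1.sub t2).add t3
      rw [add_zero] at tb
      exact tw.mul tb
    have hmeas : ∀ m, AEStronglyMeasurable (F m) μ := fun m => (hFint m).aestronglyMeasurable
    have hconv := tendsto_integral_of_dominated_convergence bound hmeas hbound_int hdom hlim
    refine tendsto_nhds_unique hconv ?_
    simp_rw [hFzero]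
    exact tendsto_const_nhds
  -- Step 2: `a → ∞`
  have hlim2 : ∀ u : Torus.energySpace d, Tendsto (fun n : ℕ =>
      Torus.galerkinWeight (‖u‖ ^ 2 / ((n : ℝ) + 1)) * Flim u) atTop (𝓝 (Flim u)) := by
    intro u
    have h1 : Tendsto (fun n : ℕ => ‖u‖ ^ 2 / ((n : ℝ) + 1)) atTop (𝓝 0) := by
      have h := (tendsto_one_div_add_atTop_nhds_zero_nat (𝕜 := ℝ)).const_mul (‖u‖ ^ 2)
      rw [mul_zero] at h
      refine h.congr fun n => ?_
      ring
    have h3 := ((Torus.continuous_galerkinWeight.tendsto 0).comp h1).mul_const (Flim u)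
    rw [Torus.galerkinWeight_zero, one_mul] at h3
    exact h3
  have hdom2 : ∀ n : ℕ, ∀ᵐ u ∂μ,
      ‖Torus.galerkinWeight (‖u‖ ^ 2 / ((n : ℝ) + 1)) * Flim u‖ ≤ Cw * ‖Flim u‖ := by
    intro n
    refine ae_of_all _ fun u => ?_
    rw [norm_mul, Real.norm_eq_abs]
    exact mul_le_mul_of_nonneg_right (hCw _) (norm_nonneg _)
  have hmeas2 : ∀ n : ℕ, AEStronglyMeasurable
      (fun u : Torus.energySpace d => Torus.galerkinWeight (‖u‖ ^ 2 / ((n : ℝ) + 1)) * Flim u) μ := by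
    intro n
    have hc : Continuous fun u : Torus.energySpace d =>
        Torus.galerkinWeight (‖u‖ ^ 2 / ((n : ℝ) + 1)) :=
      Torus.continuous_galerkinWeight.comp ((continuous_norm.pow 2).div_const _)
    exact hc.aestronglyMeasurable.mul hFlim_int.aestronglyMeasurable
  have hconv2 := tendsto_integral_of_dominated_convergence (fun u => Cw * ‖Flim u‖) hmeas2
    (hFlim_int.norm.const_mul Cw) hdom2 (ae_of_all _ hlim2)
  have hFlim0 : ∫ u, Flim u ∂μ = 0 := by
    refine tendsto_nhds_unique hconv2 ?_
    simp_rw [hlevel]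
    exact tendsto_const_nhds
  -- read off the energy equation
  have hsplit : ∫ u, Flim u ∂μ = (∫ u, Torus.pairing u.1 f ∂μ) - ν * ∫ u, G u ∂μ := by
    rw [hFlim]
    simp_rw [hpair]
    rw [integral_sub hI1 (hI2.const_mul ν), integral_const_mul]
  have hens : (Torus.ensembleEnstrophy μ).toReal = ∫ u, G u ∂μ := by
    rw [Torus.ensembleEnstrophy, integral_toReal Torus.measurable_eGradNormSq_coe.aemeasurable
      hμ.ae_eGradNormSq_lt_top]
  rw [hens]
  linarith [hsplit.symm.trans hFlim0]

/-- **P1 `stub_energyEq_of_stressMoment`: the 3-D conditional mean energy EQUALITY** (the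
`d = 3` companion of the vendored two-dimensional `Torus.IsStationaryStatisticalSolution.energy_eq`,
FMRT 2001, Ch. IV Thm. 2.2 / App. B.1). A stationary statistical solution `μ` of the
Navier–Stokes equations on `T³` at `(ν, f)`, `f ∈ L²`, whose inertial force has finite second
`V′`-moment, `∫ ‖B(u,u)‖²_{V′} dμ < ∞` with
`‖B(u,u)‖_{V′} = sup {|∫ (u ⊗ u) : ∇w| : w smooth, div-free, mean-zero, ‖∇w‖₂² ≤ 1}`, satisfies
the mean energy EQUALITY `ν ∫ ‖∇u‖² dμ = ∫ (u, f) dμ`, for every real `ν`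
(`energy_eq_of_stressMoment` with `Fintype.card (Fin 3) = 3`). Lions' `L⁴L⁴` class is the special
case `‖B(u,u)‖_{V′} ≤ ‖u‖²_{L⁴}`.
[cite: FMRTTurbulence2001, Ch. IV §2 Thm. 2.2 with App. B.1; Def. 1.3 (1.29)–(1.31)] -/
theorem stub_energyEq_of_stressMoment :
    ∀ (ν : ℝ) (f : UnitAddTorus (Fin 3) → EuclideanSpace ℝ (Fin 3))
      (μ : Measure (Torus.energySpace (Fin 3))),
      Torus.IsStationaryStatisticalSolution ν f μ → MemLp f 2 volume →
      ∫⁻ u, (⨆ (w : UnitAddTorus (Fin 3) → EuclideanSpace ℝ (Fin 3))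
          (_ : Torus.IsSmooth w ∧ Torus.IsDivFree w ∧ Torus.HasZeroMean w ∧ Torus.eGradNormSq w ≤ 1),
          ‖Torus.inertialPairing u.1 w‖ₑ) ^ 2 ∂μ ≠ ⊤ →
      ν * (Torus.ensembleEnstrophy μ).toReal = ∫ u, Torus.pairing u.1 f ∂μ :=
  fun _ _ _ hμ hf hS => energy_eq_of_stressMoment (by simp) (by simp) hμ hf hS

end Summit.AnomalousDissipation.AnomalousDissipation.Theorems.MomentParityResolvedDissipation.StressEnergyEq

end
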